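import Literature.NumberTheory.Automorphic.UFormGroupKCasimirTensor
import Literature.NumberTheory.Automorphic.GKModulesProofs
import Literature.NumberTheory.Automorphic.GKModulesSmoothVectorsProofs
import Literature.NumberTheory.Automorphic.DiscreteAutomorphicRepArchModule
import HarnessLib

/-!
# The `K`-Casimir of a unitary representation of `U(α, β)` on its `K`-blocks, and the block bound

Topic `NumberTheory/Automorphic`; namespace `Literature.NumberTheory.Automorphic`. Theorems with proofs and two
definitions with bodies (`upqKCasimirVec`, `upqKBlockScalar`); no named fact, no `sorry`.

For `G = U(α, β)` (`uFormGroup α β`, `K = G ∩ U(N)`, `𝔨 ⊆ 𝔤`), the pseudo-orthonormal basis `(w_a)` of `𝔨` for the trace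
form (★ `upqKVec`, `B(w_a, w_b) = −δ_ab`), and a unitary strongly continuous representation `π` of `G` on a Hilbert space
`E` with differential `dπ` on the smooth vectors (★ `dπ`, ★ `harishChandraRepLie`):

* §1 **`upqKCasimirVec π v = −Σ_a dπ(w_a) (dπ(w_a) v)`** (the `K`-Casimir `Ω_K = Σ_a w_a w'_a` through `dπ`): additivity
  and homogeneity on smooth vectors, and POSITIVITY **`inner_upqKCasimirVec_self`**: `⟪Ω_K v, v⟫ = Σ_a ‖dπ(w_a) v‖²`
  (`dπ(X)` is skew-Hermitian for unitary `π`, ★ `inner_dπ_left_eq_neg`).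
* §2 `coe_kCasimirOp_apply` (on `H_K^∞`, `Ω_K` is ★ `GKCasimir.op` of the `𝔨`-part through ★ `harishChandraRepLie`) and
  **`apply_upqKCasimirVec`**: `π(k) Ω_K v = Ω_K π(k) v` on `H_K^∞` (★ `GKCasimir.op_commK`, ★
  `upq_kCasimirTensor_AdK_invariant`, ★ `isGKModule_harishChandra_holds`).
* §3 `K`-BLOCKS `W ≤ E` (finite-dimensional, `K`-stable, inside the smooth vectors): `dπ_mem_kBlock` (`dπ(𝔨) W ⊆ W`, by
  the weak derivative of ★ `IsGKModule` and a separating functional), `upqKCasimirVec_mem_kBlock`, and SCHUR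
  **`exists_upqKBlockScalar`**: on a `K`-irreducible block `Ω_K` acts by a real scalar `q_W ≥ 0`; the definition
  **`upqKBlockScalar π W`** of that scalar with `upqKBlockScalar_nonneg`, `upqKCasimirVec_eq_upqKBlockScalar_smul`.
* §4 THE BLOCK BOUND **`norm_apply_le_of_kBlock`**: if bounded operators `T j` satisfy `T j (v + Ω_K v) = T (j+1) v`
  on `H_K^∞` for `j < n`, then `‖T 0 v‖ ≤ ((1 + q_W)^n)⁻¹ ‖T n‖ ‖v‖` on `W` — the block constant of Harish-Chandra's
  proof that `π(f)`, `f ∈ C_c^∞(G)`, is of trace class (there `T j = π((1 + Ω_K)^j f)` by integration by parts).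

Citations: V. S. Varadarajan, *An introduction to harmonic analysis on semisimple Lie groups* (1989), §5.4, Thm. 22 and
its proof via `E = 1 + ω_K` (pp. 159–161); A. W. Knapp, *Representation theory of semisimple groups* (1986), Thm. 10.2,
(10.4)–(10.6); A. W. Knapp (2002), V.§4; A. Borel, N. Wallach (2000), II §1.1–1.3.
-/

noncomputable section

open scoped TensorProduct InnerProductSpace ComplexConjugate

namespace Literature.NumberTheory.Automorphic

open Literature.Algebra.Lie
open Literature.RepresentationTheory.KonnoKonno2007 Literature.RepresentationTheory.KonnoKonno2007.RealDualPair
open Literature.RepresentationTheory.KonnoKonno2007.RealDualPair.UForm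
open Literature.RepresentationTheory.BorelWallach2000

-- Mathlib idiom (as in `GKModules`, `GKCohomologyCasimir`): commutator bracket on `Module.End`
attribute [local instance 100] LieRing.ofAssociativeRing

variable {α β : Type*} [Fintype α] [DecidableEq α] [Fintype β] [DecidableEq β]

/-! ## §1 The `K`-Casimir `Ω_K = −Σ_a dπ(w_a)²` on vectors -/

variable {E : Type*} [NormedAddCommGroup E] [InnerProductSpace ℂ E] [CompleteSpace E]
  (π : ContRepresentation ℂ (uFormGroup α β).carrier E)

/-- **The `K`-Casimir through `dπ`: `Ω_K v := −Σ_a dπ(w_a) (dπ(w_a) v)`** (`= Σ_a dπ(w_a) dπ(w'_a) v` with `w'_a = −w_a`;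
meaningful on smooth vectors). [cite: Varadarajan1989, §5.4 (proof of Thm. 22: `E = 1 + ω_K`)] -/
def upqKCasimirVec (v : E) : E :=
  -∑ a, dπ (uFormGroup α β) π (dπ (uFormGroup α β) π v (upqKVec α β a)) (upqKVec α β a)

omit [CompleteSpace E] in
/-- `dπ(X) 0 = 0` (the differential is linear in the vector). [cite: BorelWallach2000, Ch. 0 §2.5] -/
theorem dπ_zero_left (X : (uFormGroup α β).lie) : dπ (uFormGroup α β) π 0 X = 0 := by
  have h := dπ_smul_left (uFormGroup α β) π (Submodule.zero_mem (smoothVectors (uFormGroup α β) π)) (0 : ℂ) X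
  rwa [zero_smul, zero_smul] at h

omit [CompleteSpace E] in
/-- `Ω_K 0 = 0`. [cite: BorelWallach2000, Ch. 0 §2.5] -/
theorem upqKCasimirVec_zero : upqKCasimirVec π 0 = 0 := by
  simp only [upqKCasimirVec, dπ_zero_left, Finset.sum_const_zero, neg_zero]

/-- `Ω_K` is additive on smooth vectors (`dπ(X)` is linear on `H^∞`). [cite: BorelWallach2000, Ch. 0 §2.5] -/
theorem upqKCasimirVec_add (hc : π.IsStronglyContinuous) {v w : E} (hv : v ∈ smoothVectors (uFormGroup α β) π)
    (hw : w ∈ smoothVectors (uFormGroup α β) π) :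
    upqKCasimirVec π (v + w) = upqKCasimirVec π v + upqKCasimirVec π w := by
  simp only [upqKCasimirVec]
  rw [← neg_add, ← Finset.sum_add_distrib]
  congr 1
  refine Finset.sum_congr rfl fun a _ => ?_
  rw [dπ_add_left _ π hv hw,
    dπ_add_left _ π (dπ_mem_smoothVectors _ π hc hv _) (dπ_mem_smoothVectors _ π hc hw _)]

/-- `Ω_K` is homogeneous on smooth vectors (`dπ(X)` is linear on `H^∞`). [cite: BorelWallach2000, Ch. 0 §2.5] -/
theorem upqKCasimirVec_smul (hc : π.IsStronglyContinuous) {v : E} (hv : v ∈ smoothVectors (uFormGroup α β) π)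
    (c : ℂ) : upqKCasimirVec π (c • v) = c • upqKCasimirVec π v := by
  simp only [upqKCasimirVec, smul_neg, Finset.smul_sum]
  congr 1
  refine Finset.sum_congr rfl fun a _ => ?_
  rw [dπ_smul_left _ π hv, dπ_smul_left _ π (dπ_mem_smoothVectors _ π hc hv _)]

/-- **Positivity of `Ω_K`: `⟪Ω_K v, v⟫ = Σ_a ‖dπ(w_a) v‖²`** for a smooth vector `v` of a unitary `π` (`dπ(w_a)` is
skew-Hermitian). [cite: Varadarajan1989, §5.4] [cite: Knapp1986, (10.4)–(10.6)] -/
theorem inner_upqKCasimirVec_self (hu : π.IsUnitary) (hc : π.IsStronglyContinuous) {v : E}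
    (hv : v ∈ smoothVectors (uFormGroup α β) π) :
    ⟪upqKCasimirVec π v, v⟫_ℂ = ∑ a, (((‖dπ (uFormGroup α β) π v (upqKVec α β a)‖ ^ 2 : ℝ)) : ℂ) := by
  rw [upqKCasimirVec, inner_neg_left, sum_inner, ← Finset.sum_neg_distrib]
  refine Finset.sum_congr rfl fun a _ => ?_
  rw [inner_dπ_left_eq_neg _ π hu (dπ_mem_smoothVectors _ π hc hv _) hv, neg_neg, inner_self_eq_norm_sq_to_K]
  norm_cast

/-! ## §2 `Ω_K` on the Harish-Chandra module and its commutation with `K` -/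

/-- On `H_K^∞`, ★ `GKCasimir.op` of the `𝔨`-part `(w_a, w'_a)` through ★ `harishChandraRepLie` is `Ω_K`.
[cite: BorelWallach2000, II §1.3 (1)–(2)] -/
theorem coe_kCasimirOp_apply (hc : π.IsStronglyContinuous) (v : harishChandraSpace (uFormGroup α β) π) :
    ((GKCasimir.op (uFormGroup α β) (harishChandraRepLie (uFormGroup α β) π hc) (upqKVec α β) (upqKDual α β) v :
        harishChandraSpace (uFormGroup α β) π) : E) = upqKCasimirVec π v := by
  simp only [GKCasimir.op_apply, upqKDual_eq_neg, map_neg, LinearMap.neg_apply, Finset.sum_neg_distrib,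
    Submodule.coe_neg, AddSubmonoidClass.coe_finsetSum, coe_harishChandraRepLie_apply, upqKCasimirVec]

/-- **`π(k) Ω_K v = Ω_K π(k) v` for `k ∈ K` and `v ∈ H_K^∞`** (the `𝔨`-Casimir tensor is `Ad(K)`-invariant, §0, and
`H_K^∞` is a `(𝔤, K)`-module, ★ `isGKModule_harishChandra_holds`). [cite: Knapp2002, V.§4] [cite: Varadarajan1989, §5.4] -/
theorem apply_upqKCasimirVec (hc : π.IsStronglyContinuous) (k : (uFormGroup α β).maximalCompact) {v : E}
    (hv : v ∈ harishChandraSpace (uFormGroup α β) π) :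
    π (Subgroup.inclusion (uFormGroup α β).maximalCompact_le_carrier k) (upqKCasimirVec π v) =
      upqKCasimirVec π (π (Subgroup.inclusion (uFormGroup α β).maximalCompact_le_carrier k) v) := by
  have hGK := isGKModule_harishChandra_holds (uFormGroup α β) π hc (harishChandraRepK (uFormGroup α β) π)
    (fun _ _ => rfl) (isHarishChandraModuleOf_harishChandraRepLie (uFormGroup α β) π hc)
  have h := GKCasimir.op_commK (uFormGroup α β) (harishChandraRepK (uFormGroup α β) π)
    (harishChandraRepLie (uFormGroup α β) π hc) hGK.ad_compat (upqKVec α β) (upqKDual α β)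
    upq_kCasimirTensor_AdK_invariant k
  have h' := congrArg (fun f => ((f ⟨v, hv⟩ : harishChandraSpace (uFormGroup α β) π) : E)) h
  simp only [LinearMap.comp_apply, coe_kCasimirOp_apply, coe_harishChandraRepK_apply] at h'
  exact h'.symm

/-! ## §3 `K`-blocks: `Ω_K` preserves them and acts by a non-negative scalar on the irreducible ones -/

variable (W : Submodule ℂ E)

omit [CompleteSpace E] in
/-- Vectors of a finite-dimensional `K`-stable subspace are `K`-finite. [cite: BorelWallach2000, Ch. 0 §2.4] -/
theorem mem_kFiniteVectors_of_kBlock [FiniteDimensional ℂ W]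
    (hWK : ∀ (k : (uFormGroup α β).maximalCompact) (v : E), v ∈ W →
      π (Subgroup.inclusion (uFormGroup α β).maximalCompact_le_carrier k) v ∈ W)
    {v : E} (hv : v ∈ W) : v ∈ kFiniteVectors (uFormGroup α β) π := by
  rw [mem_kFiniteVectors_iff]
  refine Submodule.finiteDimensional_of_le (S₂ := W) (Submodule.span_le.2 ?_)
  rintro _ ⟨k, rfl⟩
  exact hWK k v hv

omit [CompleteSpace E] in
/-- A finite-dimensional `K`-stable subspace of smooth vectors lies in `H_K^∞ = H^∞ ∩ H_(K)`. [cite: BorelWallach2000, Ch. 0 §2.4] -/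
theorem kBlock_le_harishChandraSpace [FiniteDimensional ℂ W] (hWs : W ≤ smoothVectors (uFormGroup α β) π)
    (hWK : ∀ (k : (uFormGroup α β).maximalCompact) (v : E), v ∈ W →
      π (Subgroup.inclusion (uFormGroup α β).maximalCompact_le_carrier k) v ∈ W) :
    W ≤ harishChandraSpace (uFormGroup α β) π :=
  fun _ hv => ⟨hWs hv, mem_kFiniteVectors_of_kBlock π W hWK hv⟩

/-- **`dπ(𝔨)` preserves every finite-dimensional `K`-stable subspace of smooth vectors**: `t ↦ π(exp tX) v` stays in
`W`, and its (weak) derivative `dπ(X) v` (★ `IsGKModule.hasWeakDeriv`) is annihilated by every functional vanishing on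
`W`. [cite: Varadarajan1989, §5.4] [cite: KnappVogan1995, (1.86)] -/
theorem dπ_mem_kBlock [FiniteDimensional ℂ W] (hc : π.IsStronglyContinuous)
    (hWs : W ≤ smoothVectors (uFormGroup α β) π)
    (hWK : ∀ (k : (uFormGroup α β).maximalCompact) (v : E), v ∈ W →
      π (Subgroup.inclusion (uFormGroup α β).maximalCompact_le_carrier k) v ∈ W)
    {X : (uFormGroup α β).lie} (hX : X ∈ (uFormGroup α β).kInLie) {v : E} (hv : v ∈ W) :
    dπ (uFormGroup α β) π v X ∈ W := by
  have hWhc := kBlock_le_harishChandraSpace π W hWs hWK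
  have hGK := isGKModule_harishChandra_holds (uFormGroup α β) π hc (harishChandraRepK (uFormGroup α β) π)
    (fun _ _ => rfl) (isHarishChandraModuleOf_harishChandraRepLie (uFormGroup α β) π hc)
  rw [RealMatrixGroup.mem_kInLie_iff] at hX
  set Y : (uFormGroup α β).compactLie := ⟨(X : Matrix (α ⊕ β) (α ⊕ β) ℂ), hX⟩ with hY
  have hYX : LieSubalgebra.inclusion (uFormGroup α β).compactLie_le_lie Y = X := Subtype.ext rfl
  set W₀ : Submodule ℂ (harishChandraSpace (uFormGroup α β) π) :=
    W.comap (harishChandraSpace (uFormGroup α β) π).subtype with hW₀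
  by_contra hnot
  have hu : harishChandraRepLie (uFormGroup α β) π hc X ⟨v, hWhc hv⟩ ∉ W₀ := by
    intro h
    rw [hW₀, Submodule.mem_comap, Submodule.subtype_apply, coe_harishChandraRepLie_apply] at h
    exact hnot h
  obtain ⟨f, hf, hfW⟩ := Submodule.exists_dual_map_eq_bot_of_notMem hu inferInstance
  have hzero : ∀ t : ℝ,
      f (harishChandraRepK (uFormGroup α β) π ((uFormGroup α β).expK (t • Y)) ⟨v, hWhc hv⟩) = 0 := by
    intro t
    have hmem : harishChandraRepK (uFormGroup α β) π ((uFormGroup α β).expK (t • Y)) ⟨v, hWhc hv⟩ ∈ W₀ := by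
      rw [hW₀, Submodule.mem_comap, Submodule.subtype_apply, coe_harishChandraRepK_apply]
      exact hWK _ v hv
    have h1 : f _ ∈ W₀.map f := Submodule.mem_map_of_mem hmem
    rw [hfW, Submodule.mem_bot] at h1
    exact h1
  have hd := hGK.hasWeakDeriv Y ⟨v, hWhc hv⟩ f
  rw [hYX] at hd
  have hconst : (fun t : ℝ =>
      f (harishChandraRepK (uFormGroup α β) π ((uFormGroup α β).expK (t • Y)) ⟨v, hWhc hv⟩)) = fun _ => 0 :=
    funext hzero
  rw [hconst] at hd
  exact hf (hd.unique (hasDerivAt_const (0 : ℝ) (0 : ℂ)))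

/-- `Ω_K` preserves every finite-dimensional `K`-stable subspace of smooth vectors. [cite: Varadarajan1989, §5.4] -/
theorem upqKCasimirVec_mem_kBlock [FiniteDimensional ℂ W] (hc : π.IsStronglyContinuous)
    (hWs : W ≤ smoothVectors (uFormGroup α β) π)
    (hWK : ∀ (k : (uFormGroup α β).maximalCompact) (v : E), v ∈ W →
      π (Subgroup.inclusion (uFormGroup α β).maximalCompact_le_carrier k) v ∈ W)
    {v : E} (hv : v ∈ W) : upqKCasimirVec π v ∈ W :=
  Submodule.neg_mem _ (Submodule.sum_mem _ fun a _ =>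
    dπ_mem_kBlock π W hc hWs hWK (upqKVec_mem a) (dπ_mem_kBlock π W hc hWs hWK (upqKVec_mem a) hv))

/-- **SCHUR: on a `K`-irreducible finite-dimensional `K`-stable subspace of smooth vectors, `Ω_K` acts by a real scalar
`q ≥ 0`** (an eigenspace of `Ω_K|_W` is `K`-stable, §2, hence all of `W`; the eigenvalue is `Σ_a‖dπ(w_a)v‖²/‖v‖²`).
[cite: Varadarajan1989, §5.4 (proof of Thm. 22)] [cite: Knapp1986, (10.5)] -/
theorem exists_upqKBlockScalar [FiniteDimensional ℂ W] (hu : π.IsUnitary) (hc : π.IsStronglyContinuous)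
    (hWs : W ≤ smoothVectors (uFormGroup α β) π)
    (hWK : ∀ (k : (uFormGroup α β).maximalCompact) (v : E), v ∈ W →
      π (Subgroup.inclusion (uFormGroup α β).maximalCompact_le_carrier k) v ∈ W)
    (hWirr : ∀ W' : Submodule ℂ E, W' ≤ W →
      (∀ (k : (uFormGroup α β).maximalCompact) (v : E), v ∈ W' →
        π (Subgroup.inclusion (uFormGroup α β).maximalCompact_le_carrier k) v ∈ W') → W' = ⊥ ∨ W' = W) :
    ∃ q : ℝ, 0 ≤ q ∧ ∀ v ∈ W, upqKCasimirVec π v = (q : ℂ) • v := by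
  by_cases hW : W = ⊥
  · refine ⟨0, le_rfl, fun v hv => ?_⟩
    rw [hW, Submodule.mem_bot] at hv
    rw [hv, upqKCasimirVec_zero, smul_zero]
  haveI : Nontrivial W := Submodule.nontrivial_iff_ne_bot.2 hW
  have hWhc := kBlock_le_harishChandraSpace π W hWs hWK
  -- `Ω_K` restricted to `W`
  let QW : W →ₗ[ℂ] W :=
    { toFun := fun w => ⟨upqKCasimirVec π w, upqKCasimirVec_mem_kBlock π W hc hWs hWK w.2⟩
      map_add' := fun w w' => Subtype.ext (upqKCasimirVec_add π hc (hWs w.2) (hWs w'.2))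
      map_smul' := fun c w => Subtype.ext (upqKCasimirVec_smul π hc (hWs w.2) c) }
  have hQW : ∀ w : W, ((QW w : W) : E) = upqKCasimirVec π w := fun _ => rfl
  obtain ⟨μ, hμ⟩ := Module.End.exists_eigenvalue QW
  obtain ⟨w, hw⟩ := hμ.exists_hasEigenvector
  rw [Module.End.hasEigenvector_iff, Module.End.mem_eigenspace_iff] at hw
  -- the eigenspace, as a `K`-stable subspace of `E`
  set V : Submodule ℂ E := (Module.End.eigenspace QW μ).map W.subtype with hVdef
  have hVle : V ≤ W := by
    rintro _ ⟨w', -, rfl⟩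
    exact w'.2
  have hVK : ∀ (k : (uFormGroup α β).maximalCompact) (v : E), v ∈ V →
      π (Subgroup.inclusion (uFormGroup α β).maximalCompact_le_carrier k) v ∈ V := by
    rintro k _ ⟨w', hw', rfl⟩
    rw [SetLike.mem_coe, Module.End.mem_eigenspace_iff] at hw'
    refine ⟨⟨π (Subgroup.inclusion (uFormGroup α β).maximalCompact_le_carrier k) w', hWK k _ w'.2⟩, ?_, rfl⟩
    rw [SetLike.mem_coe, Module.End.mem_eigenspace_iff]
    apply Subtype.ext
    have h1 := congrArg (fun x : W => π (Subgroup.inclusion (uFormGroup α β).maximalCompact_le_carrier k) (x : E)) hw'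
    simp only [hQW, Submodule.coe_smul, map_smul] at h1
    rw [hQW, Submodule.coe_smul]
    rw [← apply_upqKCasimirVec π hc k (hWhc w'.2)]
    exact h1
  have hVne : V ≠ ⊥ := by
    intro hV
    have hwV : (w : E) ∈ V := ⟨w, by rw [SetLike.mem_coe, Module.End.mem_eigenspace_iff]; exact hw.1, rfl⟩
    rw [hV, Submodule.mem_bot] at hwV
    exact hw.2 (Subtype.ext hwV)
  have hVW : V = W := (hWirr V hVle hVK).resolve_left hVne
  have hall : ∀ v ∈ W, upqKCasimirVec π v = μ • v := by
    intro v hv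
    have hv' : v ∈ V := hVW ▸ hv
    obtain ⟨w', hw', rfl⟩ := hv'
    rw [SetLike.mem_coe, Module.End.mem_eigenspace_iff] at hw'
    have h1 := congrArg (fun x : W => (x : E)) hw'
    simpa only [hQW, Submodule.coe_smul, Submodule.subtype_apply] using h1
  -- the eigenvalue is real and non-negative
  have hw0 : (w : E) ≠ 0 := fun h => hw.2 (Subtype.ext h)
  set s : ℝ := ∑ a, ‖dπ (uFormGroup α β) π (w : E) (upqKVec α β a)‖ ^ 2 with hs
  have hs0 : 0 ≤ s := Finset.sum_nonneg fun a _ => sq_nonneg _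
  have hn : 0 < ‖(w : E)‖ ^ 2 := by positivity
  have hinner := inner_upqKCasimirVec_self π hu hc (hWs w.2)
  rw [hall _ w.2, inner_smul_left, inner_self_eq_norm_sq_to_K, ← Complex.ofReal_sum] at hinner
  -- hinner : conj μ * (‖w‖:ℂ)^2 = (s : ℂ)
  have hconj : (starRingEnd ℂ) μ = ((s / ‖(w : E)‖ ^ 2 : ℝ) : ℂ) := by
    rw [Complex.ofReal_div, eq_div_iff (by exact_mod_cast hn.ne'), Complex.ofReal_pow]
    exact hinner
  have hμ_eq : μ = ((s / ‖(w : E)‖ ^ 2 : ℝ) : ℂ) := by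
    rw [← Complex.conj_conj μ, hconj, Complex.conj_ofReal]
  refine ⟨s / ‖(w : E)‖ ^ 2, div_nonneg hs0 hn.le, fun v hv => ?_⟩
  rw [hall v hv, hμ_eq]

/-- **The `K`-Casimir scalar `q_W` of a subspace `W`**: the non-negative real by which `Ω_K` acts on `W` when there is
one (§3 `exists_upqKBlockScalar`: every `K`-irreducible block of smooth vectors), and `0` otherwise.
[cite: Varadarajan1989, §5.4 (`c_ξ(E)`)] [cite: Knapp1986, Thm. 10.2 (proof)] -/
def upqKBlockScalar (W : Submodule ℂ E) : ℝ :=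
  open scoped Classical in
  if h : ∃ q : ℝ, 0 ≤ q ∧ ∀ v ∈ W, upqKCasimirVec π v = (q : ℂ) • v then h.choose else 0

omit [CompleteSpace E] in
/-- `q_W ≥ 0`. [cite: Varadarajan1989, §5.4 (Lemma 21: `c_ξ(E) ≥ 1` for `E = 1 + ω_K`)] -/
theorem upqKBlockScalar_nonneg (W : Submodule ℂ E) : 0 ≤ upqKBlockScalar π W := by
  unfold upqKBlockScalar
  split_ifs with h
  · exact h.choose_spec.1
  · exact le_rfl

/-- **On a `K`-irreducible block, `Ω_K v = q_W • v`.** [cite: Varadarajan1989, §5.4] [cite: Knapp1986, (10.5)] -/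
theorem upqKCasimirVec_eq_upqKBlockScalar_smul [FiniteDimensional ℂ W] (hu : π.IsUnitary)
    (hc : π.IsStronglyContinuous) (hWs : W ≤ smoothVectors (uFormGroup α β) π)
    (hWK : ∀ (k : (uFormGroup α β).maximalCompact) (v : E), v ∈ W →
      π (Subgroup.inclusion (uFormGroup α β).maximalCompact_le_carrier k) v ∈ W)
    (hWirr : ∀ W' : Submodule ℂ E, W' ≤ W →
      (∀ (k : (uFormGroup α β).maximalCompact) (v : E), v ∈ W' →
        π (Subgroup.inclusion (uFormGroup α β).maximalCompact_le_carrier k) v ∈ W') → W' = ⊥ ∨ W' = W)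
    {v : E} (hv : v ∈ W) : upqKCasimirVec π v = (upqKBlockScalar π W : ℂ) • v := by
  have h := exists_upqKBlockScalar π W hu hc hWs hWK hWirr
  rw [upqKBlockScalar, dif_pos h]
  exact h.choose_spec.2 v hv

/-! ## §4 The block bound -/

/-- **THE BLOCK BOUND.** If bounded operators `T j` (`j ≤ n`) satisfy `T j (v + Ω_K v) = T (j+1) v` for every
`v ∈ H_K^∞` and `j < n` (for `T 0 = π(f)`, `f ∈ C_c^∞(G)`: `T j = π((1 + Ω_K)^j f)` by integration by parts), then on
every `K`-irreducible block `W` of smooth vectors `‖T 0 v‖ ≤ ((1 + q_W)^n)⁻¹ ‖T n‖ ‖v‖`.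
[cite: Varadarajan1989, §5.4, proof of Thm. 22] [cite: Knapp1986, Thm. 10.2, (10.4)–(10.6)] -/
theorem norm_apply_le_of_kBlock [FiniteDimensional ℂ W] (hu : π.IsUnitary) (hc : π.IsStronglyContinuous)
    (hWs : W ≤ smoothVectors (uFormGroup α β) π)
    (hWK : ∀ (k : (uFormGroup α β).maximalCompact) (v : E), v ∈ W →
      π (Subgroup.inclusion (uFormGroup α β).maximalCompact_le_carrier k) v ∈ W)
    (hWirr : ∀ W' : Submodule ℂ E, W' ≤ W →
      (∀ (k : (uFormGroup α β).maximalCompact) (v : E), v ∈ W' →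
        π (Subgroup.inclusion (uFormGroup α β).maximalCompact_le_carrier k) v ∈ W') → W' = ⊥ ∨ W' = W)
    (n : ℕ) (T : ℕ → (E →L[ℂ] E))
    (hT : ∀ j < n, ∀ v ∈ harishChandraSpace (uFormGroup α β) π, T j (v + upqKCasimirVec π v) = T (j + 1) v)
    {v : E} (hv : v ∈ W) :
    ‖T 0 v‖ ≤ ((1 + upqKBlockScalar π W) ^ n)⁻¹ * (‖T n‖ * ‖v‖) := by
  set q : ℝ := upqKBlockScalar π W with hqdef
  have hq : 0 ≤ q := upqKBlockScalar_nonneg π W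
  have hWhc := kBlock_le_harishChandraSpace π W hWs hWK
  set c : ℂ := ((1 + q : ℝ) : ℂ) with hcdef
  have hc0 : c ≠ 0 := by
    rw [hcdef, Ne, Complex.ofReal_eq_zero]
    exact (by positivity : (1 + q : ℝ) ≠ 0)
  have key : ∀ j ≤ n, T 0 v = (c ^ j)⁻¹ • T j v := by
    intro j hj
    induction j with
    | zero => rw [pow_zero, inv_one, one_smul]
    | succ j ih =>
      have hstep := hT j (by omega) v (hWhc hv)
      rw [upqKCasimirVec_eq_upqKBlockScalar_smul π W hu hc hWs hWK hWirr hv] at hstep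
      have h1 : v + (q : ℂ) • v = c • v := by
        rw [hcdef, Complex.ofReal_add, Complex.ofReal_one, add_smul, one_smul]
      rw [h1, map_smul] at hstep
      rw [ih (by omega), ← hstep, smul_smul]
      congr 1
      rw [pow_succ, mul_inv, mul_assoc, inv_mul_cancel₀ hc0, mul_one]
  have hnc : ‖(c ^ n)⁻¹‖ = ((1 + q) ^ n)⁻¹ := by
    rw [norm_inv, norm_pow, hcdef, Complex.norm_real, Real.norm_of_nonneg (by positivity)]
  calc ‖T 0 v‖ = ‖(c ^ n)⁻¹ • T n v‖ := by rw [key n le_rfl]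
    _ = ((1 + q) ^ n)⁻¹ * ‖T n v‖ := by rw [norm_smul, hnc]
    _ ≤ ((1 + q) ^ n)⁻¹ * (‖T n‖ * ‖v‖) :=
        mul_le_mul_of_nonneg_left ((T n).le_opNorm v) (inv_nonneg.2 (pow_nonneg (by positivity) n))

end Literature.NumberTheory.Automorphic

end
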